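import Mathlib
import Literature.NumberTheory.LFunctions.ExplicitFormulaPsiProofs
import Literature.NumberTheory.LFunctions.ZetaZeroOrdinateSums
import Literature.NumberTheory.LFunctions.ZetaLogDerivRH
import HarnessLib

/-!
# Cramér's mean square for `ψ(x) − x` under the Riemann Hypothesis (Montgomery–Vaughan Thm. 13.5)

Topic `Literature/NumberTheory/LFunctions`. Everything in this file is PROVED (no named facts).

> **Theorem 13.5** (Montgomery–Vaughan, *Multiplicative Number Theory I*, §13.1). Assume RH. Then for
> `X ≥ 2`, `∫_X^{2X} (ψ(x) − x)² dx ≪ X²`.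

(H. Cramér, *Ein Mittelwertsatz in der Primzahltheorie*, Math. Z. 12 (1922), 147–153, in the form
`∫_1^X (ψ(x) − x)² dx/x² ≪ log X`.)  Main results (namespace `Literature.NumberTheory.LFunctions.CramerMeanSquare`):

* `integral_sq_psi_sub_self_le_of_RH` — RH → `∃ K, ∀ X ≥ 2, ∫_X^{2X} (ψ x − x)² ≤ K X²` (Thm. 13.5 as printed);
* `integral_sq_psi_sub_self_div_sq_le_of_RH` — RH → `∃ K, ∀ Y ≥ 1, ∫_1^Y (ψ y − y)²/y² ≤ K (log Y + 1)` (Cramér's form);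
* `integral_exp_neg_mul_sq_psi_exp_sub_le_of_RH` — the same in the variable `u = log y`:
  RH → `∃ K, ∀ V ≥ 0, ∫_0^V e^{−u} (ψ(e^u) − e^u)² du ≤ K (V + 1)` (MV (13.17)–(13.18)).

## Proof

A smoothed version of Montgomery–Vaughan's argument.  By the truncated explicit formula (MV Thm. 12.5, tree:
`truncatedExplicitFormula_psi_holds`) with `T = X` and RH, for `x ∈ [X, 2X]`,
`|ψ(x) − x| ≤ √x · |t(log x)| + O(log² X)` with the trigonometric sum `t(u) = Σ_{|γ| ≤ X} (m(ρ)/ρ) e^{iγu}`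
(`exists_abs_psi_sub_le`; `ψ₀` versus `ψ` costs `(log x)/2`, `abs_psi_sub_chebyshevPsi₀_le`).  Hence
`∫_X^{2X} (ψ − x)² ≤ 2∫_{log X}^{log 2X} e^{2u} |t(u)|² du + O(X log⁴X)`, and `e^{2u} 1_{[log X, log 2X]}` is
majorised by `8X²` times the tent `1 − |u − u₀|` (`u₀ = log X + ½`).  The tent's transform is
`≤ 6/(1 + ξ²)` (`norm_integral_tent_exp_le`, by two explicit antiderivatives), which gives the weighted mean value
inequality `∫ tent · |Σ c_j e^{iλ_j u}|² ≤ 6 Σ_{j,k} |c_j||c_k|/(1 + (λ_j − λ_k)²)` (`integral_tent_mul_normSq_trigSum_le`).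
With `|c_ρ| = m(ρ)/|ρ|` the remaining pair sum `Σ_{ρ₁,ρ₂} m₁m₂/(|ρ₁||ρ₂|(1 + (γ₁ − γ₂)²))` is bounded uniformly
(`exists_pairSum_le`, the smoothed form of MV (13.16)): AM–GM reduces it to `Σ_ρ m(ρ) log(|γ|+2)/|ρ|²`, and both
this and the inner sums `Σ_{ρ₂} m(ρ₂)/(1 + (γ₁ − γ₂)²) ≪ log(|γ₁| + 2)` follow from the local count
`N(c + ½) − N(c − ½) ≪ log(|c| + 2)` (MV Thm. 10.13; tree `ZeroOrdinateSums.exists_sum_le_of_abs_im_sub_le` and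
its shell estimates).  The dyadic and logarithmic forms follow by summing over `[2^j, 2^{j+1}]` and substituting
`y = e^u` (`intervalIntegral.integral_comp_mul_deriv_of_deriv_nonneg`).

## References

* H. L. Montgomery, R. C. Vaughan, *Multiplicative Number Theory I. Classical Theory*, CUP 2007, §13.1,
  Thm. 13.5, (13.16)–(13.18); Thm. 12.5; Thm. 10.13. [cite: MontgomeryVaughan2007, Thm. 13.5]
* H. Cramér, Ein Mittelwertsatz in der Primzahltheorie, *Math. Z.* 12 (1922), 147–153.
-/

noncomputable section

open MeasureTheory Set Finset Complex Real intervalIntegral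
open scoped ComplexConjugate

namespace Literature.NumberTheory.LFunctions.CramerMeanSquare

open ZeroOrdinateSums

/-! ### §1 The tent weight: `‖∫_{-1}^{1} (1 - |v|) e^{iξv} dv‖ ≤ min(2, 4/ξ²) ≤ 6/(1+ξ²)` -/

/-- Antiderivative on `[0,1]`: `d/dv [−e^{iξv}(1 + iξ(1−v))] = ξ²(1−v)e^{iξv}`. [folklore] -/
private theorem hasDerivAt_tentRight (ξ v : ℝ) :
    HasDerivAt (fun v : ℝ ↦ -(cexp (I * ξ * v) * (1 + I * ξ * (1 - v))))
      ((ξ : ℂ) ^ 2 * (1 - v) * cexp (I * ξ * v)) v := by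
  have h1 : HasDerivAt (fun y : ℝ ↦ cexp (I * ξ * y)) (cexp (I * ξ * v) * (I * ξ * 1)) v :=
    ((hasDerivAt_id (v : ℂ)).const_mul (I * ξ)).cexp.comp_ofReal
  have h2 : HasDerivAt (fun y : ℝ ↦ (1 + I * ξ * (1 - y) : ℂ)) (I * ξ * (-1)) v :=
    ((((hasDerivAt_id (v : ℂ)).const_sub 1).const_mul (I * ξ)).const_add 1).comp_ofReal
  have h := (h1.mul h2).neg
  convert h using 1 <;> first | rfl | (rw [show (ξ : ℂ) ^ 2 = -((I * ξ) ^ 2) by rw [mul_pow, I_sq]; ring]; ring)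

/-- Antiderivative on `[-1,0]`: `d/dv [e^{iξv}(1 − iξ(1+v))] = ξ²(1+v)e^{iξv}`. [folklore] -/
private theorem hasDerivAt_tentLeft (ξ v : ℝ) :
    HasDerivAt (fun v : ℝ ↦ cexp (I * ξ * v) * (1 - I * ξ * (1 + v)))
      ((ξ : ℂ) ^ 2 * (1 + v) * cexp (I * ξ * v)) v := by
  have h1 : HasDerivAt (fun y : ℝ ↦ cexp (I * ξ * y)) (cexp (I * ξ * v) * (I * ξ * 1)) v :=
    ((hasDerivAt_id (v : ℂ)).const_mul (I * ξ)).cexp.comp_ofReal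
  have h2 : HasDerivAt (fun y : ℝ ↦ (1 - I * ξ * (1 + y) : ℂ)) (-(I * ξ * 1)) v :=
    ((((hasDerivAt_id (v : ℂ)).const_add 1).const_mul (I * ξ)).const_sub 1).comp_ofReal
  have h := h1.mul h2
  convert h using 1 <;> first | rfl | (rw [show (ξ : ℂ) ^ 2 = -((I * ξ) ^ 2) by rw [mul_pow, I_sq]; ring]; ring)

/-- The tent weight `1 − |v|` is nonnegative on `[-1, 1]`. [folklore] -/
private theorem tent_nonneg {v : ℝ} (hv : v ∈ Icc (-1 : ℝ) 1) : 0 ≤ 1 - |v| := by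
  rw [Set.mem_Icc] at hv; have := abs_le.2 hv; linarith

/-- The tent weight is continuous. [folklore] -/
private theorem continuous_tent : Continuous fun v : ℝ ↦ 1 - |v| := continuous_const.sub continuous_abs

/-- `ξ² ∫_{-1}^{1} (1−|v|) e^{iξv} dv = 2 − e^{iξ} − e^{−iξ}`. [folklore] -/
private theorem sq_mul_integral_tent_exp (ξ : ℝ) :
    (ξ : ℂ) ^ 2 * ∫ v in (-1 : ℝ)..1, ((1 - |v| : ℝ) : ℂ) * cexp (I * ξ * v)
      = 2 - cexp (I * ξ) - cexp (-(I * ξ)) := by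
  have hcont : Continuous fun v : ℝ ↦ ((1 - |v| : ℝ) : ℂ) * cexp (I * ξ * v) :=
    (continuous_ofReal.comp continuous_tent).mul (by fun_prop)
  rw [← integral_add_adjacent_intervals (b := 0) (hcont.intervalIntegrable _ _) (hcont.intervalIntegrable _ _),
    mul_add, ← intervalIntegral.integral_const_mul, ← intervalIntegral.integral_const_mul]
  -- left half
  have hL : ∫ v in (-1 : ℝ)..0, (ξ : ℂ) ^ 2 * (((1 - |v| : ℝ) : ℂ) * cexp (I * ξ * v))
      = (1 - I * ξ) - cexp (-(I * ξ)) := by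
    -- value G(0) - G(-1)
    have heq : EqOn (fun v : ℝ ↦ (ξ : ℂ) ^ 2 * (((1 - |v| : ℝ) : ℂ) * cexp (I * ξ * v)))
        (fun v : ℝ ↦ (ξ : ℂ) ^ 2 * (1 + v) * cexp (I * ξ * v)) (uIcc (-1 : ℝ) 0) := by
      intro v hv
      rw [Set.uIcc_of_le (by norm_num), Set.mem_Icc] at hv
      simp only [abs_of_nonpos hv.2, sub_neg_eq_add, ofReal_add, ofReal_one]
      ring
    rw [integral_congr heq, integral_eq_sub_of_hasDerivAt (fun v _ ↦ hasDerivAt_tentLeft ξ v)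
      ((by fun_prop : Continuous fun v : ℝ ↦ (ξ : ℂ) ^ 2 * (1 + v) * cexp (I * ξ * v)).intervalIntegrable _ _)]
    simp
  -- right half
  have hR : ∫ v in (0 : ℝ)..1, (ξ : ℂ) ^ 2 * (((1 - |v| : ℝ) : ℂ) * cexp (I * ξ * v))
      = -cexp (I * ξ) - (-(I * ξ) + -1) := by
    have heq : EqOn (fun v : ℝ ↦ (ξ : ℂ) ^ 2 * (((1 - |v| : ℝ) : ℂ) * cexp (I * ξ * v)))
        (fun v : ℝ ↦ (ξ : ℂ) ^ 2 * (1 - v) * cexp (I * ξ * v)) (uIcc (0 : ℝ) 1) := by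
      intro v hv
      rw [Set.uIcc_of_le (by norm_num), Set.mem_Icc] at hv
      simp only [abs_of_nonneg hv.1, ofReal_sub, ofReal_one]
      ring
    rw [integral_congr heq, integral_eq_sub_of_hasDerivAt (fun v _ ↦ hasDerivAt_tentRight ξ v)
      ((by fun_prop : Continuous fun v : ℝ ↦ (ξ : ℂ) ^ 2 * (1 - v) * cexp (I * ξ * v)).intervalIntegrable _ _)]
    simp
  rw [hL, hR]; ring

/-- **Tent transform bound**: `‖∫_{-1}^{1} (1−|v|) e^{iξv} dv‖ ≤ 6/(1 + ξ²)`. [folklore] -/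
private theorem norm_integral_tent_exp_le (ξ : ℝ) :
    ‖∫ v in (-1 : ℝ)..1, ((1 - |v| : ℝ) : ℂ) * cexp (I * ξ * v)‖ ≤ 6 / (1 + ξ ^ 2) := by
  set J := ∫ v in (-1 : ℝ)..1, ((1 - |v| : ℝ) : ℂ) * cexp (I * ξ * v) with hJ
  -- trivial bound 2
  have h2 : ‖J‖ ≤ 2 := by
    have h := intervalIntegral.norm_integral_le_of_norm_le_const (a := (-1 : ℝ)) (b := 1) (C := 1)
      (f := fun v : ℝ ↦ ((1 - |v| : ℝ) : ℂ) * cexp (I * ξ * v)) (fun v hv ↦ ?_)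
    · exact h.trans (by norm_num)
    · rw [Set.uIoc_of_le (by norm_num)] at hv
      rw [norm_mul, Complex.norm_exp]
      have : (I * ξ * v).re = 0 := by simp
      rw [this, Real.exp_zero, mul_one, Complex.norm_real, Real.norm_eq_abs,
        abs_of_nonneg (tent_nonneg ⟨hv.1.le, hv.2⟩)]
      linarith [abs_nonneg v]
  -- oscillatory bound 4/ξ²
  have h4 : ξ ^ 2 * ‖J‖ ≤ 4 := by
    have h := sq_mul_integral_tent_exp ξ
    have hn : ‖(ξ : ℂ) ^ 2 * J‖ ≤ 4 := by
      rw [h]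
      calc ‖(2 : ℂ) - cexp (I * ξ) - cexp (-(I * ξ))‖
          ≤ ‖(2 : ℂ) - cexp (I * ξ)‖ + ‖cexp (-(I * ξ))‖ := norm_sub_le _ _
        _ ≤ (‖(2 : ℂ)‖ + ‖cexp (I * ξ)‖) + ‖cexp (-(I * ξ))‖ := by gcongr; exact norm_sub_le _ _
        _ = 4 := by
          rw [Complex.norm_exp, Complex.norm_exp]
          simp; norm_num
    rw [norm_mul, norm_pow, Complex.norm_real, Real.norm_eq_abs, sq_abs] at hn
    exact hn
  rw [div_eq_mul_inv, le_mul_inv_iff₀ (by positivity)]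
  nlinarith [norm_nonneg J, sq_nonneg ξ]

/-- Scaled and shifted: `‖∫_{u₀-1}^{u₀+1} (1−|u−u₀|) e^{iΔu} du‖ ≤ 6/(1+Δ²)`. [folklore] -/
private theorem norm_integral_tent_shift_exp_le (u₀ Δ : ℝ) :
    ‖∫ u in (u₀ - 1)..(u₀ + 1), ((1 - |u - u₀| : ℝ) : ℂ) * cexp (I * Δ * u)‖ ≤ 6 / (1 + Δ ^ 2) := by
  have h := intervalIntegral.integral_comp_add_right (fun u : ℝ ↦ ((1 - |u - u₀| : ℝ) : ℂ) * cexp (I * Δ * u)) u₀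
    (a := -1) (b := 1)
  rw [show (-1 : ℝ) + u₀ = u₀ - 1 by ring, show (1 : ℝ) + u₀ = u₀ + 1 by ring] at h
  rw [← h]
  have e : (fun x : ℝ ↦ ((1 - |x + u₀ - u₀| : ℝ) : ℂ) * cexp (I * Δ * ((x + u₀ : ℝ) : ℂ)))
      = fun x : ℝ ↦ cexp (I * Δ * u₀) * (((1 - |x| : ℝ) : ℂ) * cexp (I * Δ * x)) := by
    funext x; rw [add_sub_cancel_right, ofReal_add, mul_add, Complex.exp_add]; ring
  rw [e, intervalIntegral.integral_const_mul, norm_mul, Complex.norm_exp]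
  have : (I * Δ * u₀).re = 0 := by simp
  rw [this, Real.exp_zero, one_mul]
  exact norm_integral_tent_exp_le Δ

/-! ### §2 Weighted mean value of a finite trigonometric sum -/

variable {ι : Type*}

/-- A finite trigonometric sum `t(u) = Σ_j c_j e^{iλ_j u}` is continuous. [folklore] -/
private theorem continuous_trigSum (s : Finset ι) (c : ι → ℂ) (lam : ι → ℝ) :
    Continuous fun u : ℝ ↦ ∑ j ∈ s, c j * cexp (I * lam j * u) := by
  fun_prop

/-- `|t(u)|² = Σ_{j,k} c_j conj(c_k) e^{i(λ_j − λ_k)u}` (as a complex number). [folklore] -/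
private theorem normSq_trigSum_eq (s : Finset ι) (c : ι → ℂ) (lam : ι → ℝ) (u : ℝ) :
    ((‖∑ j ∈ s, c j * cexp (I * lam j * u)‖ ^ 2 : ℝ) : ℂ)
      = ∑ j ∈ s, ∑ k ∈ s, c j * conj (c k) * cexp (I * ((lam j - lam k : ℝ) : ℂ) * u) := by
  rw [← Complex.normSq_eq_norm_sq, ← Complex.mul_conj, map_sum, Finset.sum_mul_sum]
  refine Finset.sum_congr rfl fun j _ ↦ Finset.sum_congr rfl fun k _ ↦ ?_
  rw [map_mul, ← Complex.exp_conj]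
  have : conj (I * (lam k : ℂ) * (u : ℂ)) = -(I * lam k * u) := by
    simp [Complex.conj_ofReal]
  rw [this, mul_mul_mul_comm, ← Complex.exp_add]
  congr 1; push_cast; ring

/-- **Weighted mean value inequality** (tent weight of half-width 1):
`∫_{u₀-1}^{u₀+1} (1 − |u − u₀|)·|Σ_j c_j e^{iλ_j u}|² du ≤ 6 Σ_{j,k} |c_j||c_k|/(1 + (λ_j − λ_k)²)`. [folklore] -/
private theorem integral_tent_mul_normSq_trigSum_le (s : Finset ι) (c : ι → ℂ) (lam : ι → ℝ) (u₀ : ℝ) :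
    ∫ u in (u₀ - 1)..(u₀ + 1), (1 - |u - u₀|) * ‖∑ j ∈ s, c j * cexp (I * lam j * u)‖ ^ 2
      ≤ 6 * ∑ j ∈ s, ∑ k ∈ s, ‖c j‖ * ‖c k‖ / (1 + (lam j - lam k) ^ 2) := by
  set R := ∫ u in (u₀ - 1)..(u₀ + 1), (1 - |u - u₀|) * ‖∑ j ∈ s, c j * cexp (I * lam j * u)‖ ^ 2 with hR
  have hcontk : ∀ j k, Continuous fun u : ℝ ↦ ((1 - |u - u₀| : ℝ) : ℂ) * cexp (I * ((lam j - lam k : ℝ) : ℂ) * u) := by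
    intro j k
    exact (continuous_ofReal.comp (continuous_tent.comp (continuous_id.sub continuous_const) :)).mul (by fun_prop)
  have hC : (R : ℂ) = ∑ j ∈ s, ∑ k ∈ s, c j * conj (c k) *
      ∫ u in (u₀ - 1)..(u₀ + 1), ((1 - |u - u₀| : ℝ) : ℂ) * cexp (I * ((lam j - lam k : ℝ) : ℂ) * u) := by
    rw [hR, ← intervalIntegral.integral_ofReal]
    have e : (fun u : ℝ ↦ (((1 - |u - u₀|) * ‖∑ j ∈ s, c j * cexp (I * lam j * u)‖ ^ 2 : ℝ) : ℂ))
        = fun u : ℝ ↦ ∑ j ∈ s, ∑ k ∈ s, c j * conj (c k) * (((1 - |u - u₀| : ℝ) : ℂ) * cexp (I * ((lam j - lam k : ℝ) : ℂ) * u)) := by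
      funext u
      rw [ofReal_mul, normSq_trigSum_eq, Finset.mul_sum]
      refine Finset.sum_congr rfl fun j _ ↦ ?_
      rw [Finset.mul_sum]
      refine Finset.sum_congr rfl fun k _ ↦ ?_
      ring
    rw [e, intervalIntegral.integral_finsetSum (fun j _ ↦ ?_)]
    · refine Finset.sum_congr rfl fun j _ ↦ ?_
      rw [intervalIntegral.integral_finsetSum (fun k _ ↦ ?_)]
      · refine Finset.sum_congr rfl fun k _ ↦ ?_
        rw [intervalIntegral.integral_const_mul]
      · exact ((hcontk j k).const_mul _).intervalIntegrable _ _
    · exact (continuous_finsetSum _ fun k _ ↦ (hcontk j k).const_mul _).intervalIntegrable _ _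
  have hnorm : ‖(R : ℂ)‖ ≤ 6 * ∑ j ∈ s, ∑ k ∈ s, ‖c j‖ * ‖c k‖ / (1 + (lam j - lam k) ^ 2) := by
    rw [hC, Finset.mul_sum]
    refine (norm_sum_le _ _).trans (Finset.sum_le_sum fun j _ ↦ ?_)
    rw [Finset.mul_sum]
    refine (norm_sum_le _ _).trans (Finset.sum_le_sum fun k _ ↦ ?_)
    rw [norm_mul, norm_mul, Complex.norm_conj]
    have h := norm_integral_tent_shift_exp_le u₀ (lam j - lam k)
    calc ‖c j‖ * ‖c k‖ * ‖∫ u in (u₀ - 1)..(u₀ + 1), ((1 - |u - u₀| : ℝ) : ℂ) * cexp (I * ((lam j - lam k : ℝ) : ℂ) * u)‖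
        ≤ ‖c j‖ * ‖c k‖ * (6 / (1 + (lam j - lam k) ^ 2)) := by gcongr
      _ = _ := by ring
  have : R ≤ ‖(R : ℂ)‖ := by rw [Complex.norm_real]; exact le_abs_self R
  exact this.trans hnorm

/-! ### §3 Sums over zeros against the Cauchy kernel `1/(1 + (u − γ)²)` -/

/-- **Window bound for the Cauchy kernel**: there is `C ≥ 0` with
`Σ_{ρ ∈ F} m(ρ)/(1 + (u − γ)²) ≤ C (log(|u| + 2) + 2)` for every real `u` and every finite set `F` of
non-trivial zeros (local count `N(c + ½) − N(c − ½) ≪ log(|c|+2)` summed over unit windows). [cite: MontgomeryVaughan2007, Thm. 10.13] -/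
theorem exists_sum_order_div_one_add_sq_le : ∃ C : ℝ, 0 ≤ C ∧ ∀ (u : ℝ) (F : Finset ℂ),
    (∀ ρ ∈ F, ρ ∈ ZetaZeros.riemannZetaNontrivialZeros) →
    ∑ ρ ∈ F, (riemannZetaZeroOrder ρ : ℝ) * (1 / (1 + (u - ρ.im) ^ 2)) ≤ C * (Real.log (|u| + 2) + 2) := by
  obtain ⟨Cw, hCw0, hCw⟩ := exists_sum_le_of_abs_im_sub_le
  refine ⟨96 * Cw, by positivity, fun u F hF ↦ ?_⟩
  -- majorant on the rounded ordinates
  set ψ : ℤ → ℝ := fun k ↦ 16 / (max (|(k : ℝ) - u|) 4) ^ 2 with hψ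
  have hψ0 : ∀ k, 0 ≤ ψ k := fun k ↦ by positivity
  have hg : ∀ ρ ∈ F, 1 / (1 + (u - ρ.im) ^ 2) ≤ ψ (round ρ.im) := by
    intro ρ _
    set k := round ρ.im with hk
    have hround : |ρ.im - k| ≤ 1 / 2 := by rw [hk]; exact abs_sub_round ρ.im
    have hM4 : (4 : ℝ) ≤ max (|(k : ℝ) - u|) 4 := le_max_right _ _
    have hM0 : 0 < max (|(k : ℝ) - u|) 4 := by linarith
    simp only [hψ]
    rcases le_or_gt (|(k : ℝ) - u|) 4 with hle | hgt
    · rw [max_eq_right hle]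
      rw [div_le_div_iff₀ (by positivity) (by norm_num)]
      nlinarith [sq_nonneg (u - ρ.im)]
    · rw [max_eq_left hgt.le]
      -- |u - γ| ≥ |k - u| - 1/2 ≥ |k - u|/2
      have h1 : |(k : ℝ) - u| / 2 ≤ |u - ρ.im| := by
        have := abs_sub_abs_le_abs_sub ((k : ℝ) - u) (ρ.im - u)
        have e : (k : ℝ) - u - (ρ.im - u) = -(ρ.im - k) := by ring
        rw [e, abs_neg] at this
        rw [abs_sub_comm u]
        linarith
      have h2 : ((k : ℝ) - u) ^ 2 / 4 ≤ (u - ρ.im) ^ 2 := by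
        have h0 : 0 ≤ |(k : ℝ) - u| / 2 := by positivity
        have := pow_le_pow_left₀ h0 h1 2
        rw [div_pow, sq_abs, sq_abs] at this
        linarith
      rw [div_le_div_iff₀ (by positivity) (by positivity), sq_abs]
      nlinarith [sq_nonneg ((k : ℝ) - u)]
  have h := sum_mul_le_of_ordinate_majorant hCw hψ0 F hF hg
  refine h.trans ?_
  have hS := sum_log_div_max_sq_le (F.image fun ρ ↦ round ρ.im) u (le_refl (4 : ℝ))
  have hsqrt4 : Real.sqrt 4 = 2 := by
    rw [show (4 : ℝ) = 2 ^ 2 by norm_num, Real.sqrt_sq (by norm_num)]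
  rw [hsqrt4] at hS
  have e : ∑ k ∈ F.image (fun ρ ↦ round ρ.im), ψ k * Real.log (|(k : ℝ)| + 2)
      = 16 * ∑ k ∈ F.image (fun ρ ↦ round ρ.im), Real.log (|(k : ℝ)| + 2) / (max (|(k : ℝ) - u|) 4) ^ 2 := by
    rw [Finset.mul_sum]
    refine Finset.sum_congr rfl fun k _ ↦ ?_
    simp only [hψ]; ring
  rw [e]
  have hlog : 0 ≤ Real.log (|u| + 2) + 2 := by
    have := Real.log_nonneg (by linarith [abs_nonneg u] : (1 : ℝ) ≤ |u| + 2); linarith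
  calc Cw * (16 * ∑ k ∈ F.image (fun ρ ↦ round ρ.im), Real.log (|(k : ℝ)| + 2) / (max (|(k : ℝ) - u|) 4) ^ 2)
      ≤ Cw * (16 * (12 * (Real.log (|u| + 2) + 2) / 2)) := by gcongr
    _ = 96 * Cw * (Real.log (|u| + 2) + 2) := by ring

/-- On the critical line the modulus of a zero controls its rounded ordinate:
`(|round γ| + 1)² ≤ 16 |ρ|²` when `Re ρ = 1/2`. [folklore] -/
private theorem sq_abs_round_add_one_le {ρ : ℂ} (hρ : ρ.re = 1 / 2) :
    (|(round ρ.im : ℝ)| + 1) ^ 2 ≤ 16 * ‖ρ‖ ^ 2 := by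
  have hn : ‖ρ‖ ^ 2 = 1 / 4 + ρ.im ^ 2 := by
    rw [← Complex.normSq_eq_norm_sq, Complex.normSq_apply, hρ]; ring
  rw [hn]
  have hround : |ρ.im - round ρ.im| ≤ 1 / 2 := abs_sub_round ρ.im
  set k : ℝ := ((round ρ.im : ℤ) : ℝ) with hk
  rcases le_or_gt 1 |k| with h1 | h1
  · -- |γ| ≥ |k| - 1/2 ≥ (|k|+1)/4
    have h2 : |k| - 1 / 2 ≤ |ρ.im| := by
      have := abs_sub_abs_le_abs_sub k ρ.im
      rw [abs_sub_comm] at hround; linarith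
    have h3 : (|k| + 1) / 4 ≤ |ρ.im| := by linarith
    have h4 : ((|k| + 1) / 4) ^ 2 ≤ ρ.im ^ 2 := by
      have := pow_le_pow_left₀ (by positivity) h3 2; rwa [sq_abs] at this
    nlinarith
  · have : (|k| + 1) ^ 2 ≤ 4 := by nlinarith [abs_nonneg k]
    nlinarith [sq_nonneg ρ.im]

/-- The outer majorant `ψ(k) = 16 (log(|k|+3) + 2)/(|k|+1)²` on the rounded ordinates is nonnegative. [folklore] -/
private theorem outerMajorant_nonneg (k : ℤ) : 0 ≤ 16 * (Real.log (|(k : ℝ)| + 3) + 2) / (|(k : ℝ)| + 1) ^ 2 := by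
  have : 0 ≤ Real.log (|(k : ℝ)| + 3) := Real.log_nonneg (by linarith [abs_nonneg (k : ℝ)])
  positivity

/-- On the critical line, `(log(|γ|+2) + 2)/|ρ|² ≤ ψ(round γ)`. [folklore] -/
private theorem log_div_normSq_le_outerMajorant {ρ : ℂ} (hρ : ρ.re = 1 / 2) :
    (Real.log (|ρ.im| + 2) + 2) / ‖ρ‖ ^ 2
      ≤ 16 * (Real.log (|((round ρ.im : ℤ) : ℝ)| + 3) + 2) / (|((round ρ.im : ℤ) : ℝ)| + 1) ^ 2 := by
  have hsq := sq_abs_round_add_one_le hρ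
  have hround : |ρ.im - round ρ.im| ≤ 1 / 2 := abs_sub_round ρ.im
  set k : ℝ := ((round ρ.im : ℤ) : ℝ) with hk
  have hn0 : 0 < ‖ρ‖ ^ 2 := by
    have : ‖ρ‖ ^ 2 = 1 / 4 + ρ.im ^ 2 := by
      rw [← Complex.normSq_eq_norm_sq, Complex.normSq_apply, hρ]; ring
    rw [this]; positivity
  have hγk : |ρ.im| ≤ |k| + 1 / 2 := by
    have := abs_sub_abs_le_abs_sub ρ.im k; linarith
  have hlog : Real.log (|ρ.im| + 2) ≤ Real.log (|k| + 3) :=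
    Real.log_le_log (by positivity) (by linarith)
  have hlog0 : 0 ≤ Real.log (|ρ.im| + 2) := Real.log_nonneg (by linarith [abs_nonneg ρ.im])
  have hlk0 : 0 ≤ Real.log (|k| + 3) + 2 := by
    have := Real.log_nonneg (by linarith [abs_nonneg k] : (1 : ℝ) ≤ |k| + 3); linarith
  rw [div_le_div_iff₀ hn0 (by positivity)]
  calc (Real.log (|ρ.im| + 2) + 2) * (|k| + 1) ^ 2
      ≤ (Real.log (|k| + 3) + 2) * (16 * ‖ρ‖ ^ 2) :=
        mul_le_mul (by linarith) hsq (by positivity) hlk0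
    _ = 16 * (Real.log (|k| + 3) + 2) * ‖ρ‖ ^ 2 := by ring

/-- Per-term bound: `ψ(k) log(|k|+2) ≤ 8064/(M√M)`, `M = max(|k|, 4)` (from `log y ≤ 4 y^{1/4}`). [folklore] -/
private theorem outerMajorant_mul_log_le (k : ℤ) :
    16 * (Real.log (|(k : ℝ)| + 3) + 2) / (|(k : ℝ)| + 1) ^ 2 * Real.log (|(k : ℝ)| + 2)
      ≤ 8064 * (1 / (max (|(k : ℝ) - 0|) 4 * Real.sqrt (max (|(k : ℝ) - 0|) 4))) := by
  set n : ℝ := |(k : ℝ)| with hn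
  have hn0 : 0 ≤ n := abs_nonneg _
  rw [sub_zero]
  set M : ℝ := max n 4 with hM
  have hM4 : 4 ≤ M := le_max_right _ _
  have hM0 : 0 < M := by linarith
  -- P := log(n+3) + 2 ≤ 6 q, q = (n+3)^{1/4} ≥ 1, q² = √(n+3)
  set y : ℝ := n + 3 with hy
  have hy1 : 1 ≤ y := by linarith
  have hy0 : 0 ≤ y := by linarith
  set q : ℝ := y ^ (1 / 4 : ℝ) with hq
  have hq1 : 1 ≤ q := Real.one_le_rpow hy1 (by norm_num)
  have hlogq : Real.log y ≤ 4 * q := by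
    have := Real.log_le_rpow_div hy0 (by norm_num : (0 : ℝ) < 1 / 4)
    rw [hq]; linarith
  have hq2 : q ^ 2 = Real.sqrt y := by
    rw [hq, ← Real.rpow_mul_natCast hy0, Real.sqrt_eq_rpow]; norm_num
  set P : ℝ := Real.log y + 2 with hP
  have hlog2 : Real.log (n + 2) ≤ P := by
    have : Real.log (n + 2) ≤ Real.log y := Real.log_le_log (by linarith) (by linarith)
    have : 0 ≤ (2 : ℝ) := by norm_num
    linarith
  have hlog20 : 0 ≤ Real.log (n + 2) := Real.log_nonneg (by linarith)
  have hP0 : 0 ≤ P := by linarith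
  have hP6 : P ≤ 6 * q := by linarith
  have hPsq : P * Real.log (n + 2) ≤ 36 * Real.sqrt y := by
    calc P * Real.log (n + 2) ≤ (6 * q) * (6 * q) := by gcongr; linarith
      _ = 36 * q ^ 2 := by ring
      _ = 36 * Real.sqrt y := by rw [hq2]
  -- √y ≤ √3 √(n+1) ≤ 7/4 √(n+1)
  have hsy : Real.sqrt y ≤ 7 / 4 * Real.sqrt (n + 1) := by
    have h3 : Real.sqrt 3 ≤ 7 / 4 := by rw [Real.sqrt_le_left (by norm_num)]; norm_num
    calc Real.sqrt y ≤ Real.sqrt (3 * (n + 1)) := Real.sqrt_le_sqrt (by rw [hy]; linarith)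
      _ = Real.sqrt 3 * Real.sqrt (n + 1) := Real.sqrt_mul (by norm_num) _
      _ ≤ 7 / 4 * Real.sqrt (n + 1) := by gcongr
  have hs1 : 0 < Real.sqrt (n + 1) := Real.sqrt_pos.2 (by linarith)
  have hss : Real.sqrt (n + 1) * Real.sqrt (n + 1) = n + 1 := Real.mul_self_sqrt (by linarith)
  -- 1/((n+1)√(n+1)) ≤ 8/(M√M)
  have hcmp : M * Real.sqrt M ≤ 8 * ((n + 1) * Real.sqrt (n + 1)) := by
    rcases le_or_gt 4 n with h4 | h4
    · have hMn : M = n := max_eq_left h4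
      rw [hMn]
      have : n * Real.sqrt n ≤ (n + 1) * Real.sqrt (n + 1) := by
        gcongr <;> linarith
      nlinarith [Real.sqrt_nonneg n, mul_nonneg hn0 (Real.sqrt_nonneg n)]
    · have hM4' : M = 4 := max_eq_right h4.le
      rw [hM4', show Real.sqrt 4 = 2 by rw [show (4:ℝ) = 2 ^ 2 by norm_num, Real.sqrt_sq (by norm_num)]]
      have h1 : 1 ≤ Real.sqrt (n + 1) := Real.one_le_sqrt.2 (by linarith)
      nlinarith
  have hMM : 0 < M * Real.sqrt M := by positivity
  rw [show 16 * (Real.log (n + 3) + 2) / (n + 1) ^ 2 * Real.log (n + 2)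
      = 16 * (P * Real.log (n + 2)) / (n + 1) ^ 2 by rw [hP, hy]; ring]
  -- 16 P log(n+2) · M√M ≤ 16·36·(7/4)√(n+1) · 8 (n+1)√(n+1) = 8064 (n+1)²
  have key : 16 * (P * Real.log (n + 2)) * (M * Real.sqrt M) ≤ 8064 * (n + 1) ^ 2 := by
    have hA : P * Real.log (n + 2) ≤ 36 * (7 / 4 * Real.sqrt (n + 1)) :=
      hPsq.trans (by linarith [hsy] : 36 * Real.sqrt y ≤ 36 * (7 / 4 * Real.sqrt (n + 1)))
    calc 16 * (P * Real.log (n + 2)) * (M * Real.sqrt M)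
        ≤ 16 * (36 * (7 / 4 * Real.sqrt (n + 1))) * (8 * ((n + 1) * Real.sqrt (n + 1))) :=
          mul_le_mul (mul_le_mul_of_nonneg_left hA (by norm_num)) hcmp hMM.le (by positivity)
      _ = 8064 * (n + 1) ^ 2 := by nlinarith [hss]
  have hn1 : 0 < (n + 1) ^ 2 := by positivity
  calc 16 * (P * Real.log (n + 2)) / (n + 1) ^ 2
      ≤ (8064 * (n + 1) ^ 2 / (M * Real.sqrt M)) / (n + 1) ^ 2 := by
        gcongr
        rwa [le_div_iff₀ hMM]
    _ = 8064 * (1 / (M * Real.sqrt M)) := by field_simp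

/-- Shell bound for the outer sum: `Σ_{k ∈ K} ψ(k) log(|k|+2) ≤ 48384` for every finite `K ⊆ ℤ`. [folklore] -/
private theorem sum_outerMajorant_mul_log_le (K : Finset ℤ) :
    ∑ k ∈ K, 16 * (Real.log (|(k : ℝ)| + 3) + 2) / (|(k : ℝ)| + 1) ^ 2 * Real.log (|(k : ℝ)| + 2)
      ≤ 48384 := by
  have hT := sum_inv_max_mul_sqrt_le K 0 (le_refl (4 : ℝ))
  have hs4 : Real.sqrt 4 = 2 := by
    rw [show (4 : ℝ) = 2 ^ 2 by norm_num, Real.sqrt_sq (by norm_num)]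
  rw [hs4] at hT
  calc ∑ k ∈ K, 16 * (Real.log (|(k : ℝ)| + 3) + 2) / (|(k : ℝ)| + 1) ^ 2 * Real.log (|(k : ℝ)| + 2)
      ≤ ∑ k ∈ K, 8064 * (1 / (max (|(k : ℝ) - 0|) 4 * Real.sqrt (max (|(k : ℝ) - 0|) 4))) :=
        Finset.sum_le_sum fun k _ ↦ outerMajorant_mul_log_le k
    _ = 8064 * ∑ k ∈ K, 1 / (max (|(k : ℝ) - 0|) 4 * Real.sqrt (max (|(k : ℝ) - 0|) 4)) := by
        rw [Finset.mul_sum]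
    _ ≤ 8064 * (12 / 2) := by gcongr
    _ = 48384 := by norm_num

/-- **The pair sum (Montgomery–Vaughan (13.16), smoothed form)**: there is `K` such that for every finite
set `F` of non-trivial zeros lying on the critical line,
`Σ_{ρ₁, ρ₂ ∈ F} m(ρ₁) m(ρ₂)/(|ρ₁| |ρ₂| (1 + (γ₁ − γ₂)²)) ≤ K`. [cite: MontgomeryVaughan2007, Thm. 13.5 (13.16)] -/
theorem exists_pairSum_le : ∃ K : ℝ, ∀ F : Finset ℂ,
    (∀ ρ ∈ F, ρ ∈ ZetaZeros.riemannZetaNontrivialZeros ∧ ρ.re = 1 / 2) →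
    ∑ ρ₁ ∈ F, ∑ ρ₂ ∈ F, (riemannZetaZeroOrder ρ₁ : ℝ) * (riemannZetaZeroOrder ρ₂ : ℝ)
        / (‖ρ₁‖ * ‖ρ₂‖ * (1 + (ρ₁.im - ρ₂.im) ^ 2)) ≤ K := by
  obtain ⟨C, hC0, hC⟩ := exists_sum_order_div_one_add_sq_le
  obtain ⟨Cw, hCw0, hCw⟩ := exists_sum_le_of_abs_im_sub_le
  refine ⟨C * (Cw * 48384), fun F hF ↦ ?_⟩
  have hF1 : ∀ ρ ∈ F, ρ ∈ ZetaZeros.riemannZetaNontrivialZeros := fun ρ hρ ↦ (hF ρ hρ).1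
  have hm0 : ∀ ρ ∈ F, (0 : ℝ) ≤ riemannZetaZeroOrder ρ := fun ρ hρ ↦
    riemannZetaZeroOrder_nonneg_of_zero (ZetaZeros.riemannZetaNontrivialZeros.zeta_eq_zero (hF1 ρ hρ))
  have hn0 : ∀ ρ ∈ F, 0 < ‖ρ‖ := fun ρ hρ ↦
    norm_pos_iff.2 fun h ↦ by have := (hF ρ hρ).2; rw [h] at this; norm_num at this
  -- AM-GM and symmetry
  set m : ℂ → ℝ := fun ρ ↦ (riemannZetaZeroOrder ρ : ℝ) with hm
  have hAMGM : ∀ ρ₁ ∈ F, ∀ ρ₂ ∈ F,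
      m ρ₁ * m ρ₂ / (‖ρ₁‖ * ‖ρ₂‖ * (1 + (ρ₁.im - ρ₂.im) ^ 2))
        ≤ (m ρ₁ / ‖ρ₁‖ ^ 2 * (m ρ₂ * (1 / (1 + (ρ₁.im - ρ₂.im) ^ 2)))
          + m ρ₂ / ‖ρ₂‖ ^ 2 * (m ρ₁ * (1 / (1 + (ρ₂.im - ρ₁.im) ^ 2)))) / 2 := by
    intro ρ₁ h₁ ρ₂ h₂
    have ha := hn0 ρ₁ h₁; have hb := hn0 ρ₂ h₂
    have hD : 0 < 1 + (ρ₁.im - ρ₂.im) ^ 2 := by positivity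
    have e2 : (ρ₂.im - ρ₁.im) ^ 2 = (ρ₁.im - ρ₂.im) ^ 2 := by ring
    rw [e2]
    have key : (m ρ₁ / ‖ρ₁‖ ^ 2 * (m ρ₂ * (1 / (1 + (ρ₁.im - ρ₂.im) ^ 2)))
          + m ρ₂ / ‖ρ₂‖ ^ 2 * (m ρ₁ * (1 / (1 + (ρ₁.im - ρ₂.im) ^ 2)))) / 2
          - m ρ₁ * m ρ₂ / (‖ρ₁‖ * ‖ρ₂‖ * (1 + (ρ₁.im - ρ₂.im) ^ 2))
        = m ρ₁ * m ρ₂ / (2 * (1 + (ρ₁.im - ρ₂.im) ^ 2)) * (1 / ‖ρ₁‖ - 1 / ‖ρ₂‖) ^ 2 := by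
      field_simp
      ring
    have hnn : 0 ≤ m ρ₁ * m ρ₂ / (2 * (1 + (ρ₁.im - ρ₂.im) ^ 2)) * (1 / ‖ρ₁‖ - 1 / ‖ρ₂‖) ^ 2 :=
      mul_nonneg (div_nonneg (mul_nonneg (hm0 ρ₁ h₁) (hm0 ρ₂ h₂)) (by positivity)) (sq_nonneg _)
    linarith
  have hinner : ∀ ρ₁ ∈ F, ∑ ρ₂ ∈ F, m ρ₂ * (1 / (1 + (ρ₁.im - ρ₂.im) ^ 2))
      ≤ C * (Real.log (|ρ₁.im| + 2) + 2) := fun ρ₁ _ ↦ hC ρ₁.im F hF1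
  calc ∑ ρ₁ ∈ F, ∑ ρ₂ ∈ F, m ρ₁ * m ρ₂ / (‖ρ₁‖ * ‖ρ₂‖ * (1 + (ρ₁.im - ρ₂.im) ^ 2))
      ≤ ∑ ρ₁ ∈ F, ∑ ρ₂ ∈ F, (m ρ₁ / ‖ρ₁‖ ^ 2 * (m ρ₂ * (1 / (1 + (ρ₁.im - ρ₂.im) ^ 2)))
          + m ρ₂ / ‖ρ₂‖ ^ 2 * (m ρ₁ * (1 / (1 + (ρ₂.im - ρ₁.im) ^ 2)))) / 2 :=
        Finset.sum_le_sum fun ρ₁ h₁ ↦ Finset.sum_le_sum fun ρ₂ h₂ ↦ hAMGM ρ₁ h₁ ρ₂ h₂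
    _ = ∑ ρ₁ ∈ F, m ρ₁ / ‖ρ₁‖ ^ 2 * ∑ ρ₂ ∈ F, m ρ₂ * (1 / (1 + (ρ₁.im - ρ₂.im) ^ 2)) := by
        simp only [add_div, Finset.sum_add_distrib]
        rw [Finset.sum_comm (f := fun ρ₁ ρ₂ ↦ m ρ₂ / ‖ρ₂‖ ^ 2 * (m ρ₁ * (1 / (1 + (ρ₂.im - ρ₁.im) ^ 2))) / 2)]
        rw [← Finset.sum_add_distrib]
        refine Finset.sum_congr rfl fun ρ₁ _ ↦ ?_
        rw [Finset.mul_sum, ← Finset.sum_add_distrib]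
        refine Finset.sum_congr rfl fun ρ₂ _ ↦ ?_
        ring
    _ ≤ ∑ ρ₁ ∈ F, m ρ₁ / ‖ρ₁‖ ^ 2 * (C * (Real.log (|ρ₁.im| + 2) + 2)) := by
        refine Finset.sum_le_sum fun ρ₁ h₁ ↦ ?_
        exact mul_le_mul_of_nonneg_left (hinner ρ₁ h₁) (div_nonneg (hm0 ρ₁ h₁) (sq_nonneg _))
    _ = C * ∑ ρ₁ ∈ F, m ρ₁ * ((Real.log (|ρ₁.im| + 2) + 2) / ‖ρ₁‖ ^ 2) := by
        rw [Finset.mul_sum]; refine Finset.sum_congr rfl fun ρ₁ _ ↦ ?_; ring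
    _ ≤ C * (Cw * 48384) := by
        refine mul_le_mul_of_nonneg_left ?_ hC0
        have hmaj := sum_mul_le_of_ordinate_majorant hCw (fun k ↦ outerMajorant_nonneg k) F hF1
          (g := fun ρ ↦ (Real.log (|ρ.im| + 2) + 2) / ‖ρ‖ ^ 2)
          (ψ := fun k ↦ 16 * (Real.log (|(k : ℝ)| + 3) + 2) / (|(k : ℝ)| + 1) ^ 2)
          (fun ρ hρ ↦ log_div_normSq_le_outerMajorant (hF ρ hρ).2)
        exact hmaj.trans (mul_le_mul_of_nonneg_left (sum_outerMajorant_mul_log_le _) hCw0.le)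


/-! ### §4 `ψ₀` versus `ψ` -/

section PsiZero
open scoped Chebyshev ArithmeticFunction.vonMangoldt

/-- `0 ≤ ψ(x) − ψ₀(x) ≤ (log x)/2` for `x ≥ 1`: the normalised `ψ₀ = (ψ(x⁺) + ψ(x⁻))/2` differs from `ψ`
only at prime powers, by `Λ(x)/2`. [cite: MontgomeryVaughan2007, §12.1 (12.1)] -/
theorem abs_psi_sub_chebyshevPsi₀_le {x : ℝ} (hx : 1 ≤ x) :
    |ψ x - chebyshevPsi₀ x| ≤ Real.log x / 2 := by
  rw [PerronPsi.chebyshevPsi₀_eq]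
  have hx0 : 0 ≤ x := by linarith
  set N : ℕ := ⌊x⌋₊ with hN
  have hN1 : 1 ≤ N := Nat.floor_pos.2 hx
  have hNx : (N : ℝ) ≤ x := Nat.floor_le hx0
  -- `M = ⌈x⌉ - 1` satisfies `N - 1 ≤ M` and `M ≤ x`
  have hceil1 : 1 ≤ ⌈x⌉₊ := hN1.trans (Nat.floor_le_ceil x)
  have hMle : (((⌈x⌉₊ - 1 : ℕ) : ℝ)) ≤ x := by
    rw [Nat.cast_sub hceil1, Nat.cast_one]
    have := Nat.ceil_lt_add_one hx0
    linarith
  have hMge : ((N - 1 : ℕ) : ℝ) ≤ ((⌈x⌉₊ - 1 : ℕ) : ℝ) := by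
    exact_mod_cast Nat.sub_le_sub_right (Nat.floor_le_ceil x) 1
  -- ψ(N) = ψ(N-1) + Λ(N)
  have hstep : ψ (N : ℝ) = ψ ((N - 1 : ℕ) : ℝ) + Λ N := by
    have h1 := PerronPsi.sum_range_vonMangoldt N
    have h2 := PerronPsi.sum_range_vonMangoldt (N - 1)
    rw [Nat.sub_add_cancel hN1] at h2
    rw [← h1, ← h2, Finset.sum_range_succ]
  have hψx : ψ x = ψ (N : ℝ) := Chebyshev.psi_eq_psi_coe_floor x
  have hup : ψ x - ψ (((⌈x⌉₊ - 1 : ℕ) : ℝ)) ≤ Real.log x := by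
    have hm := Chebyshev.psi_mono hMge
    have hΛ : (Λ N : ℝ) ≤ Real.log x :=
      ArithmeticFunction.vonMangoldt_le_log.trans
        (Real.log_le_log (by exact_mod_cast hN1) hNx)
    rw [hψx, hstep]; linarith
  have hlo : ψ (((⌈x⌉₊ - 1 : ℕ) : ℝ)) ≤ ψ x := Chebyshev.psi_mono hMle
  rw [abs_le]; constructor <;> linarith

end PsiZero

/-! ### §5 The truncated zero sum on the critical line as a trigonometric sum -/

/-- The coefficient `m(ρ)/ρ` of the zero `ρ` has modulus `m(ρ)/|ρ|`. [folklore] -/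
private theorem norm_zeroCoeff {ρ : ℂ} (h : (0 : ℝ) ≤ (riemannZetaZeroOrder ρ : ℝ)) :
    ‖(riemannZetaZeroOrder ρ : ℂ) / ρ‖ = (riemannZetaZeroOrder ρ : ℝ) / ‖ρ‖ := by
  rw [norm_div, Complex.norm_intCast, abs_of_nonneg h]

/-- Members of `weilZeroIndex T` are non-trivial zeros, and under RH lie on the critical line. [folklore] -/
private theorem mem_weilZeroIndex_re (hRH : RiemannHypothesis) {T : ℝ} {ρ : ℂ}
    (hρ : ρ ∈ (weilZeroIndex_finite T).toFinset) :
    ρ ∈ ZetaZeros.riemannZetaNontrivialZeros ∧ ρ.re = 1 / 2 := by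
  rw [Set.Finite.mem_toFinset] at hρ
  have hnt : ρ ∈ ZetaZeros.riemannZetaNontrivialZeros :=
    ZetaZeros.riemannZetaNontrivialZeros.mem_of_im_ne_zero hρ.1 hρ.2.2.2.1
  exact ⟨hnt, re_eq_one_half_of_riemannHypothesis hRH hρ.1
    (ZetaZeros.riemannZetaNontrivialZeros.re_pos hnt)⟩

/-- **Under RH, `Σ_{|γ|≤T} m(ρ) x^ρ/ρ = √x · Σ_{|γ| ≤ T} (m(ρ)/ρ) e^{iγ log x}`** for `x > 0`. [cite: MontgomeryVaughan2007, §13.1 (13.17)] -/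
theorem zetaZeroSumTrunc_eq_sqrt_mul_trigSum (hRH : RiemannHypothesis) {x : ℝ} (hx : 0 < x) (T : ℝ) :
    zetaZeroSumTrunc x T
      = (Real.sqrt x : ℂ) * ∑ ρ ∈ (weilZeroIndex_finite T).toFinset,
          (riemannZetaZeroOrder ρ : ℂ) / ρ * cexp (I * ρ.im * Real.log x) := by
  unfold zetaZeroSumTrunc
  rw [Finset.mul_sum]
  refine Finset.sum_congr rfl fun ρ hρ ↦ ?_
  have hre := (mem_weilZeroIndex_re hRH hρ).2
  have hx0 : (x : ℂ) ≠ 0 := Complex.ofReal_ne_zero.2 hx.ne'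
  have hρeq : ρ = ((1 / 2 : ℝ) : ℂ) + (ρ.im : ℂ) * I := by
    rw [← Complex.re_add_im ρ, hre]; simp
  have hcpow : (x : ℂ) ^ ρ = (Real.sqrt x : ℂ) * cexp (I * (ρ.im : ℂ) * (Real.log x : ℂ)) := by
    rw [Complex.cpow_def_of_ne_zero hx0, ← Complex.ofReal_log hx.le]
    conv_lhs => rw [hρeq]
    rw [show (Real.log x : ℂ) * (((1 / 2 : ℝ) : ℂ) + (ρ.im : ℂ) * I)
        = ((Real.log x * (1 / 2) : ℝ) : ℂ) + I * (ρ.im : ℂ) * (Real.log x : ℂ) by push_cast; ring,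
      Complex.exp_add, ← Complex.ofReal_exp, ← Real.rpow_def_of_pos hx, ← Real.sqrt_eq_rpow]
  rw [hcpow]
  field_simp

/-! ### §6 The pointwise bound on `[X, 2X]` from the truncated explicit formula -/

section Pointwise
open scoped Chebyshev

/-- `log(2X)⁴ ≤ 512 X` for `X ≥ 2` (from `log y ≤ 4 y^{1/4}`). [folklore] -/
private theorem log_two_mul_pow_four_le {X : ℝ} (hX : 2 ≤ X) : Real.log (2 * X) ^ 4 ≤ 512 * X := by
  have h0 : 0 ≤ 2 * X := by linarith
  have h := Real.log_le_rpow_div h0 (by norm_num : (0 : ℝ) < 1 / 4)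
  have hl0 : 0 ≤ Real.log (2 * X) := Real.log_nonneg (by linarith)
  have hq0 : 0 ≤ (2 * X) ^ (1 / 4 : ℝ) := Real.rpow_nonneg h0 _
  have h4 : ((2 * X) ^ (1 / 4 : ℝ)) ^ 4 = 2 * X := by
    rw [← Real.rpow_mul_natCast h0]; norm_num
  calc Real.log (2 * X) ^ 4 ≤ ((2 * X) ^ (1 / 4 : ℝ) / (1 / 4)) ^ 4 := by gcongr
    _ = 256 * ((2 * X) ^ (1 / 4 : ℝ)) ^ 4 := by ring
    _ = 512 * X := by rw [h4]; ring

/-- **Under RH: `|ψ(x) − x| ≤ √x·|Σ_{|γ|≤X} (m(ρ)/ρ) x^{iγ}| + M log²(2X)` for `X ≥ 2`, `x ∈ [X, 2X]`**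
(MV Thm. 12.5 with `T = X`: `ψ₀(x) = x − Σ x^ρ/ρ − log 2π − ½log(1−x⁻²) + R`, `|R| ≪ log²`). [cite: MontgomeryVaughan2007, Thm. 13.5] -/
theorem exists_abs_psi_sub_le (hRH : RiemannHypothesis) : ∃ M : ℝ, 0 ≤ M ∧ ∀ X : ℝ, 2 ≤ X →
    ∀ x ∈ Icc X (2 * X),
      |ψ x - x| ≤ Real.sqrt x * ‖∑ ρ ∈ (weilZeroIndex_finite X).toFinset,
          (riemannZetaZeroOrder ρ : ℂ) / ρ * cexp (I * ρ.im * Real.log x)‖ + M * Real.log (2 * X) ^ 2 := by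
  obtain ⟨C, hC⟩ := truncatedExplicitFormula_psi_holds 2 (by norm_num)
  set C' := max C 0 with hC'
  refine ⟨9 * C' + 7, by positivity, fun X hX x hx ↦ ?_⟩
  rw [Set.mem_Icc] at hx
  have hx2 : 2 ≤ x := hX.trans hx.1
  have hx0 : 0 < x := by linarith
  have hx1 : 1 ≤ x := by linarith
  set L : ℝ := Real.log (2 * X) with hL
  -- log 4 > 1
  have hlog4 : 1 < Real.log 4 := by
    rw [Real.lt_log_iff_exp_lt (by norm_num)]
    have := Real.exp_one_lt_d9; linarith
  have hL1 : 1 ≤ L := by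
    have : Real.log 4 ≤ L := Real.log_le_log (by norm_num) (by linarith)
    linarith
  have hLsq : L ≤ L ^ 2 := by nlinarith
  have hlogx : Real.log x ≤ L := Real.log_le_log hx0 hx.2
  have hlogx0 : 0 ≤ Real.log x := Real.log_nonneg hx1
  have hlogxX : Real.log (x * X) ≤ 2 * L := by
    have h2X : (2 * X) ≠ 0 := by positivity
    have : Real.log (x * X) ≤ Real.log ((2 * X) * (2 * X)) :=
      Real.log_le_log (by positivity) (by nlinarith)
    rw [Real.log_mul h2X h2X] at this
    linarith
  have hlogxX0 : 0 ≤ Real.log (x * X) := Real.log_nonneg (by nlinarith)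
  -- the explicit formula at `T = X`
  have hEF := hC x hx2 X hX
  set S := zetaZeroSumTrunc x X with hS
  set t := ∑ ρ ∈ (weilZeroIndex_finite X).toFinset,
    (riemannZetaZeroOrder ρ : ℂ) / ρ * cexp (I * ρ.im * Real.log x) with ht
  have hSnorm : ‖S‖ = Real.sqrt x * ‖t‖ := by
    rw [hS, zetaZeroSumTrunc_eq_sqrt_mul_trigSum hRH hx0, norm_mul, Complex.norm_real, Real.norm_eq_abs,
      abs_of_nonneg (Real.sqrt_nonneg x)]
  -- the remainder bound: ≤ C' (log x + 2 log²(xX)) ≤ 9 C' L²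
  have hRle : C * (Real.log x * min 1 (x / (X * primePowDist x)) + x / X * Real.log (x * X) ^ 2)
      ≤ 9 * C' * L ^ 2 := by
    have hA0 : 0 ≤ Real.log x * min 1 (x / (X * primePowDist x)) + x / X * Real.log (x * X) ^ 2 := by
      have : 0 ≤ min 1 (x / (X * primePowDist x)) :=
        le_min zero_le_one (div_nonneg hx0.le (mul_nonneg (by linarith) (primePowDist_nonneg x)))
      positivity
    have h1 : Real.log x * min 1 (x / (X * primePowDist x)) ≤ L := by
      calc Real.log x * min 1 (x / (X * primePowDist x)) ≤ Real.log x * 1 :=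
            mul_le_mul_of_nonneg_left (min_le_left _ _) hlogx0
        _ ≤ L := by linarith
    have h2 : x / X * Real.log (x * X) ^ 2 ≤ 2 * (2 * L) ^ 2 := by
      have hxX : x / X ≤ 2 := by rw [div_le_iff₀ (by linarith)]; linarith
      have : Real.log (x * X) ^ 2 ≤ (2 * L) ^ 2 := pow_le_pow_left₀ hlogxX0 hlogxX 2
      calc x / X * Real.log (x * X) ^ 2 ≤ 2 * (2 * L) ^ 2 :=
            mul_le_mul hxX this (sq_nonneg _) (by norm_num)
        _ = 2 * (2 * L) ^ 2 := rfl
    calc C * (Real.log x * min 1 (x / (X * primePowDist x)) + x / X * Real.log (x * X) ^ 2)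
        ≤ C' * (Real.log x * min 1 (x / (X * primePowDist x)) + x / X * Real.log (x * X) ^ 2) :=
          mul_le_mul_of_nonneg_right (le_max_left _ _) hA0
      _ ≤ C' * (L + 2 * (2 * L) ^ 2) := by gcongr
      _ ≤ 9 * C' * L ^ 2 := by nlinarith [le_max_right C 0]
  -- the two constants of (12.3)
  have hc1 : |Real.log (2 * π)| ≤ 2 := by
    have hπ := Real.pi_lt_d2
    have hπ3 := Real.pi_gt_three
    have h1 : (1 : ℝ) ≤ 2 * π := by linarith
    rw [abs_of_nonneg (Real.log_nonneg h1), Real.log_le_iff_le_exp (by linarith)]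
    have he : (2.7 : ℝ) < Real.exp 1 := by have := Real.exp_one_gt_d9; linarith
    have he2 : Real.exp 2 = Real.exp 1 * Real.exp 1 := by rw [← Real.exp_add]; norm_num
    nlinarith [Real.exp_pos 1]
  have hc2 : |1 / 2 * Real.log (1 - 1 / x ^ 2)| ≤ 1 := by
    have hy0 : 3 / 4 ≤ 1 - 1 / x ^ 2 := by
      have : 1 / x ^ 2 ≤ 1 / 4 := by
        rw [div_le_div_iff₀ (by positivity) (by norm_num)]; nlinarith
      linarith
    have hy1 : 1 - 1 / x ^ 2 ≤ 1 := by
      have : 0 ≤ 1 / x ^ 2 := by positivity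
      linarith
    have hlo := Real.one_sub_inv_le_log_of_pos (by linarith : (0 : ℝ) < 1 - 1 / x ^ 2)
    have hhi := Real.log_nonpos (by linarith) hy1
    have : (1 - 1 / x ^ 2)⁻¹ ≤ 4 / 3 := by
      rw [inv_eq_one_div, div_le_div_iff₀ (by linarith) (by norm_num)]; linarith
    rw [abs_le]; constructor <;> linarith
  -- |ψ₀ x − x| ≤ ‖S‖ + 3 + 9 C' L²
  have hψ0 : |chebyshevPsi₀ x - x| ≤ ‖S‖ + 3 + 9 * C' * L ^ 2 := by
    have e : ((chebyshevPsi₀ x - x : ℝ) : ℂ)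
        = ((chebyshevPsi₀ x : ℂ) - ((x : ℂ) - S - (Real.log (2 * π) : ℂ) - ((1 / 2 * Real.log (1 - 1 / x ^ 2) : ℝ) : ℂ)))
          - S - (Real.log (2 * π) : ℂ) - ((1 / 2 * Real.log (1 - 1 / x ^ 2) : ℝ) : ℂ) := by
      push_cast; ring
    have hn : |chebyshevPsi₀ x - x| = ‖((chebyshevPsi₀ x - x : ℝ) : ℂ)‖ := by
      rw [Complex.norm_real, Real.norm_eq_abs]
    rw [hn, e]
    have hEF' : ‖(chebyshevPsi₀ x : ℂ) - ((x : ℂ) - S - (Real.log (2 * π) : ℂ)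
        - ((1 / 2 * Real.log (1 - 1 / x ^ 2) : ℝ) : ℂ))‖ ≤ 9 * C' * L ^ 2 := by
      refine le_trans ?_ (hEF.trans hRle)
      apply le_of_eq; congr 2; push_cast; ring
    set A := (chebyshevPsi₀ x : ℂ) - ((x : ℂ) - S - (Real.log (2 * π) : ℂ)
        - ((1 / 2 * Real.log (1 - 1 / x ^ 2) : ℝ) : ℂ)) with hA
    set B := (Real.log (2 * π) : ℂ) with hB
    set D := ((1 / 2 * Real.log (1 - 1 / x ^ 2) : ℝ) : ℂ) with hD
    have hBn : ‖B‖ ≤ 2 := by rw [hB, Complex.norm_real, Real.norm_eq_abs]; exact hc1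
    have hDn : ‖D‖ ≤ 1 := by rw [hD, Complex.norm_real, Real.norm_eq_abs]; exact hc2
    calc ‖A - S - B - D‖ ≤ ‖A - S - B‖ + ‖D‖ := norm_sub_le _ _
      _ ≤ ‖A - S‖ + ‖B‖ + ‖D‖ := by gcongr; exact norm_sub_le _ _
      _ ≤ ‖A‖ + ‖S‖ + ‖B‖ + ‖D‖ := by gcongr; exact norm_sub_le _ _
      _ ≤ 9 * C' * L ^ 2 + ‖S‖ + 2 + 1 := by gcongr
      _ = ‖S‖ + 3 + 9 * C' * L ^ 2 := by ring
  have hψψ0 := abs_psi_sub_chebyshevPsi₀_le hx1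
  have h3 : (3 : ℝ) ≤ 3 * L ^ 2 := by nlinarith
  calc |ψ x - x| = |(ψ x - chebyshevPsi₀ x) + (chebyshevPsi₀ x - x)| := by ring_nf
    _ ≤ |ψ x - chebyshevPsi₀ x| + |chebyshevPsi₀ x - x| := abs_add_le _ _
    _ ≤ Real.log x / 2 + (‖S‖ + 3 + 9 * C' * L ^ 2) := add_le_add hψψ0 hψ0
    _ ≤ L ^ 2 + (Real.sqrt x * ‖t‖ + 3 * L ^ 2 + 9 * C' * L ^ 2) := by rw [hSnorm]; linarith
    _ = Real.sqrt x * ‖t‖ + (9 * C' + 4) * L ^ 2 := by ring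
    _ ≤ Real.sqrt x * ‖t‖ + (9 * C' + 7) * L ^ 2 := by nlinarith [le_max_right C 0]

end Pointwise

/-! ### §7 Cramér's mean square under RH (Montgomery–Vaughan Thm. 13.5) -/

section MeanSquare
open scoped Chebyshev

/-- `(ψ y − y)²` is interval integrable on every `[a, b]` with `0 ≤ a ≤ b` (bounded and measurable). [folklore] -/
private theorem intervalIntegrable_sq_psi_sub {a b : ℝ} (ha : 0 ≤ a) (hab : a ≤ b) :
    IntervalIntegrable (fun y ↦ (ψ y - y) ^ 2) MeasureTheory.volume a b := by
  rw [intervalIntegrable_iff_integrableOn_Ioc_of_le hab]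
  have hmeas : Measurable fun y : ℝ ↦ (ψ y - y) ^ 2 :=
    (Chebyshev.psi_mono.measurable.sub measurable_id).pow_const 2
  refine MeasureTheory.Measure.integrableOn_of_bounded (M := (ψ b + b) ^ 2) (by simp)
    hmeas.aestronglyMeasurable ?_
  refine (MeasureTheory.ae_restrict_iff' measurableSet_Ioc).2 (Filter.Eventually.of_forall fun y hy ↦ ?_)
  have hy0 : 0 ≤ y := ha.trans hy.1.le
  have hψ := Chebyshev.psi_mono hy.2
  have hψ0 := Chebyshev.psi_nonneg y
  rw [Real.norm_eq_abs, abs_pow, ← sq_abs (ψ b + b)]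
  refine pow_le_pow_left₀ (abs_nonneg _) ?_ 2
  rw [abs_le, abs_of_nonneg (by linarith)]
  constructor <;> linarith [hy.2]

/-- **Cramér's mean square under RH** (Montgomery–Vaughan, *Multiplicative Number Theory I*, Thm. 13.5;
H. Cramér 1922): assuming the Riemann Hypothesis there is `K` with
`∫_X^{2X} (ψ(x) − x)² dx ≤ K X²` for all `X ≥ 2` — on average `ψ(x) = x + O(√x)`, a `(log X)⁴` better than
the pointwise von Koch bound gives. Proof (smoothed form of MV's): the explicit formula (MV Thm. 12.5, tree
`truncatedExplicitFormula_psi_holds`) with `T = X` leaves `|ψ − x| ≤ √x |Σ_{|γ|≤X} (m/ρ) x^{iγ}| + O(log²X)`;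
in `u = log x` the square of the zero sum is integrated against a tent majorant of `e^{2u}·1_{[log X, log 2X]}`,
whose transform is `≪ 1/(1 + (γ₁ − γ₂)²)`, and the resulting pair sum over zeros is bounded by the local counts
`N(t+1) − N(t) ≪ log t` (MV (13.16)). [cite: MontgomeryVaughan2007, Thm. 13.5] -/
theorem integral_sq_psi_sub_self_le_of_RH (hRH : RiemannHypothesis) :
    ∃ K : ℝ, ∀ X : ℝ, 2 ≤ X → ∫ x in X..(2 * X), (ψ x - x) ^ 2 ≤ K * X ^ 2 := by
  obtain ⟨M, hM0, hM⟩ := exists_abs_psi_sub_le hRH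
  obtain ⟨KZ, hKZ⟩ := exists_pairSum_le
  set KZ' := max KZ 0 with hKZ'
  refine ⟨96 * KZ' + 1024 * M ^ 2, fun X hX ↦ ?_⟩
  have hX0 : 0 < X := by linarith
  have hX2 : X ≤ 2 * X := by linarith
  set F := (weilZeroIndex_finite X).toFinset with hF
  set t : ℝ → ℂ := fun u ↦ ∑ ρ ∈ F, (riemannZetaZeroOrder ρ : ℂ) / ρ * cexp (I * ρ.im * u) with ht
  have htc : Continuous t := continuous_trigSum F (fun ρ ↦ (riemannZetaZeroOrder ρ : ℂ) / ρ) Complex.im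
  have hF' : ∀ ρ ∈ F, ρ ∈ ZetaZeros.riemannZetaNontrivialZeros ∧ ρ.re = 1 / 2 :=
    fun ρ hρ ↦ mem_weilZeroIndex_re hRH hρ
  -- (a) pointwise on [X, 2X]
  have hL4 := log_two_mul_pow_four_le hX
  have hpt : ∀ x ∈ Icc X (2 * X), (ψ x - x) ^ 2 ≤ 2 * (x * ‖t (Real.log x)‖ ^ 2) + 1024 * M ^ 2 * X := by
    intro x hx
    have h := hM X hX x hx
    have hx0 : 0 ≤ x := hX0.le.trans hx.1
    have ha0 : 0 ≤ Real.sqrt x * ‖t (Real.log x)‖ + M * Real.log (2 * X) ^ 2 := by positivity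
    have hsq : (ψ x - x) ^ 2 ≤ (Real.sqrt x * ‖t (Real.log x)‖ + M * Real.log (2 * X) ^ 2) ^ 2 := by
      rw [← sq_abs (ψ x - x)]; exact pow_le_pow_left₀ (abs_nonneg _) h 2
    have hsx : Real.sqrt x ^ 2 = x := Real.sq_sqrt hx0
    calc (ψ x - x) ^ 2 ≤ (Real.sqrt x * ‖t (Real.log x)‖ + M * Real.log (2 * X) ^ 2) ^ 2 := hsq
      _ ≤ 2 * (Real.sqrt x * ‖t (Real.log x)‖) ^ 2 + 2 * (M * Real.log (2 * X) ^ 2) ^ 2 := by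
          nlinarith [sq_nonneg (Real.sqrt x * ‖t (Real.log x)‖ - M * Real.log (2 * X) ^ 2)]
      _ = 2 * (x * ‖t (Real.log x)‖ ^ 2) + 2 * M ^ 2 * (Real.log (2 * X) ^ 4) := by rw [mul_pow, hsx]; ring
      _ ≤ 2 * (x * ‖t (Real.log x)‖ ^ 2) + 2 * M ^ 2 * (512 * X) := by gcongr
      _ = _ := by ring
  -- (b) integrate over [X, 2X]
  have hcont_g : ContinuousOn (fun x : ℝ ↦ 2 * (x * ‖t (Real.log x)‖ ^ 2) + 1024 * M ^ 2 * X) (uIcc X (2 * X)) := by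
    have hlog : ContinuousOn Real.log (uIcc X (2 * X)) :=
      Real.continuousOn_log.mono fun x hx ↦ by
        rw [Set.uIcc_of_le hX2] at hx; exact ne_of_gt (hX0.trans_le hx.1)
    have : ContinuousOn (fun x ↦ ‖t (Real.log x)‖) (uIcc X (2 * X)) :=
      continuous_norm.comp_continuousOn (htc.comp_continuousOn hlog)
    fun_prop
  have hI1 : ∫ x in X..(2 * X), (ψ x - x) ^ 2
      ≤ ∫ x in X..(2 * X), (2 * (x * ‖t (Real.log x)‖ ^ 2) + 1024 * M ^ 2 * X) :=
    intervalIntegral.integral_mono_on hX2 (intervalIntegrable_sq_psi_sub hX0.le hX2)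
      (hcont_g.intervalIntegrable) hpt
  have hI2 : ∫ x in X..(2 * X), (2 * (x * ‖t (Real.log x)‖ ^ 2) + 1024 * M ^ 2 * X)
      = 2 * (∫ x in X..(2 * X), x * ‖t (Real.log x)‖ ^ 2) + 1024 * M ^ 2 * X * X := by
    have hc1 : IntervalIntegrable (fun x : ℝ ↦ 2 * (x * ‖t (Real.log x)‖ ^ 2)) MeasureTheory.volume X (2 * X) := by
      refine ContinuousOn.intervalIntegrable ?_
      have hlog : ContinuousOn Real.log (uIcc X (2 * X)) :=
        Real.continuousOn_log.mono fun x hx ↦ by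
          rw [Set.uIcc_of_le hX2] at hx; exact ne_of_gt (hX0.trans_le hx.1)
      have : ContinuousOn (fun x ↦ ‖t (Real.log x)‖) (uIcc X (2 * X)) :=
        continuous_norm.comp_continuousOn (htc.comp_continuousOn hlog)
      fun_prop
    have hc2 : IntervalIntegrable (fun _ : ℝ ↦ 1024 * M ^ 2 * X) MeasureTheory.volume X (2 * X) :=
      intervalIntegrable_const
    have e1 : ∫ x in X..(2 * X), 2 * (x * ‖t (Real.log x)‖ ^ 2)
        = 2 * ∫ x in X..(2 * X), x * ‖t (Real.log x)‖ ^ 2 :=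
      intervalIntegral.integral_const_mul _ _
    have e2 : ∫ _ in X..(2 * X), (1024 * M ^ 2 * X : ℝ) = (2 * X - X) * (1024 * M ^ 2 * X) := by
      rw [intervalIntegral.integral_const, smul_eq_mul]
    rw [intervalIntegral.integral_add hc1 hc2, e1, e2]
    ring
  -- (c) substitution u = log x
  have hI3 : ∫ x in X..(2 * X), x * ‖t (Real.log x)‖ ^ 2
      = ∫ u in Real.log X..Real.log (2 * X), Real.exp (2 * u) * ‖t u‖ ^ 2 := by
    have hsub := intervalIntegral.integral_comp_mul_deriv' (a := X) (b := 2 * X) (f := Real.log)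
      (f' := fun x ↦ x⁻¹) (g := fun u ↦ Real.exp (2 * u) * ‖t u‖ ^ 2)
      (fun x hx ↦ Real.hasDerivAt_log (by rw [Set.uIcc_of_le hX2] at hx; exact ne_of_gt (hX0.trans_le hx.1)))
      (continuousOn_inv₀.mono fun x hx ↦ by
        rw [Set.uIcc_of_le hX2] at hx; exact ne_of_gt (hX0.trans_le hx.1))
      ((by fun_prop : Continuous fun u ↦ Real.exp (2 * u) * ‖t u‖ ^ 2).continuousOn)
    rw [← hsub]
    refine intervalIntegral.integral_congr fun x hx ↦ ?_
    rw [Set.uIcc_of_le hX2] at hx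
    have hx0 : 0 < x := hX0.trans_le hx.1
    simp only [Function.comp_apply]
    rw [show Real.exp (2 * Real.log x) = x ^ 2 by
      rw [mul_comm, ← Real.rpow_def_of_pos hx0, Real.rpow_two]]
    field_simp
  -- (d) domination by the tent weight, u₀ = log X + 1/2
  set u₀ := Real.log X + 1 / 2 with hu₀
  have hlog2 : Real.log 2 < 1 := by
    rw [Real.log_lt_iff_lt_exp (by norm_num)]; have := Real.exp_one_gt_d9; linarith
  have hlog2X : Real.log (2 * X) = Real.log 2 + Real.log X := Real.log_mul (by norm_num) hX0.ne'
  have hlogmono : Real.log X ≤ Real.log (2 * X) := Real.log_le_log hX0 hX2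
  have hI4 : ∫ u in Real.log X..Real.log (2 * X), Real.exp (2 * u) * ‖t u‖ ^ 2
      ≤ ∫ u in Real.log X..Real.log (2 * X), 8 * X ^ 2 * ((1 - |u - u₀|) * ‖t u‖ ^ 2) := by
    refine intervalIntegral.integral_mono_on hlogmono ((by fun_prop : Continuous fun u ↦
        Real.exp (2 * u) * ‖t u‖ ^ 2).intervalIntegrable _ _)
      (((continuous_tent.comp (continuous_id.sub continuous_const)).mul
        (htc.norm.pow 2)).const_mul _ |>.intervalIntegrable _ _) fun u hu ↦ ?_
    have hexp : Real.exp (2 * u) ≤ 4 * X ^ 2 := by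
      calc Real.exp (2 * u) ≤ Real.exp (2 * Real.log (2 * X)) := Real.exp_le_exp.2 (by linarith [hu.2])
        _ = (2 * X) ^ 2 := by
            rw [mul_comm, ← Real.rpow_def_of_pos (by linarith : (0:ℝ) < 2 * X), Real.rpow_two]
        _ = 4 * X ^ 2 := by ring
    have htent : 1 / 2 ≤ 1 - |u - u₀| := by
      have : |u - u₀| ≤ 1 / 2 := by rw [abs_le]; constructor <;> linarith [hu.1, hu.2]
      linarith
    have hn0 : 0 ≤ ‖t u‖ ^ 2 := sq_nonneg _
    have hkey := mul_le_mul_of_nonneg_left htent (by positivity : (0 : ℝ) ≤ 8 * X ^ 2 * ‖t u‖ ^ 2)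
    calc Real.exp (2 * u) * ‖t u‖ ^ 2 ≤ 4 * X ^ 2 * ‖t u‖ ^ 2 := by gcongr
      _ ≤ 8 * X ^ 2 * ((1 - |u - u₀|) * ‖t u‖ ^ 2) := by linarith [hkey]
  have hI5 : ∫ u in Real.log X..Real.log (2 * X), 8 * X ^ 2 * ((1 - |u - u₀|) * ‖t u‖ ^ 2)
      ≤ ∫ u in (u₀ - 1)..(u₀ + 1), 8 * X ^ 2 * ((1 - |u - u₀|) * ‖t u‖ ^ 2) := by
    refine intervalIntegral.integral_mono_interval (by linarith) hlogmono (by linarith) ?_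
      (((continuous_tent.comp (continuous_id.sub continuous_const)).mul
        (htc.norm.pow 2)).const_mul _ |>.intervalIntegrable _ _)
    refine (MeasureTheory.ae_restrict_iff' measurableSet_Ioc).2 (Filter.Eventually.of_forall fun u hu ↦ ?_)
    have : 0 ≤ 1 - |u - u₀| := tent_nonneg ⟨by linarith [hu.1], by linarith [hu.2]⟩
    positivity
  have hI6 : ∫ u in (u₀ - 1)..(u₀ + 1), 8 * X ^ 2 * ((1 - |u - u₀|) * ‖t u‖ ^ 2)
      ≤ 8 * X ^ 2 * (6 * KZ') := by
    rw [intervalIntegral.integral_const_mul]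
    refine mul_le_mul_of_nonneg_left ?_ (by positivity)
    refine (integral_tent_mul_normSq_trigSum_le F (fun ρ ↦ (riemannZetaZeroOrder ρ : ℂ) / ρ) Complex.im u₀).trans ?_
    refine mul_le_mul_of_nonneg_left ?_ (by norm_num)
    refine le_trans (le_of_eq ?_) ((hKZ F hF').trans (le_max_left _ _))
    refine Finset.sum_congr rfl fun ρ₁ h₁ ↦ Finset.sum_congr rfl fun ρ₂ h₂ ↦ ?_
    have hm1 : (0 : ℝ) ≤ (riemannZetaZeroOrder ρ₁ : ℝ) :=
      riemannZetaZeroOrder_nonneg_of_zero (ZetaZeros.riemannZetaNontrivialZeros.zeta_eq_zero (hF' ρ₁ h₁).1)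
    have hm2 : (0 : ℝ) ≤ (riemannZetaZeroOrder ρ₂ : ℝ) :=
      riemannZetaZeroOrder_nonneg_of_zero (ZetaZeros.riemannZetaNontrivialZeros.zeta_eq_zero (hF' ρ₂ h₂).1)
    rw [norm_zeroCoeff hm1, norm_zeroCoeff hm2]
    have hn1 : ‖ρ₁‖ ≠ 0 := norm_ne_zero_iff.2 fun h ↦ by
      have := (hF' ρ₁ h₁).2; rw [h] at this; norm_num at this
    have hn2 : ‖ρ₂‖ ≠ 0 := norm_ne_zero_iff.2 fun h ↦ by
      have := (hF' ρ₂ h₂).2; rw [h] at this; norm_num at this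
    field_simp
  -- (e) combine
  have hXX : X * X = X ^ 2 := by ring
  have hchain : ∫ x in X..(2 * X), x * ‖t (Real.log x)‖ ^ 2 ≤ 8 * X ^ 2 * (6 * KZ') := by
    rw [hI3]; exact hI4.trans (hI5.trans hI6)
  calc ∫ x in X..(2 * X), (ψ x - x) ^ 2
      ≤ 2 * (∫ x in X..(2 * X), x * ‖t (Real.log x)‖ ^ 2) + 1024 * M ^ 2 * X * X := by rw [← hI2]; exact hI1
    _ ≤ 2 * (8 * X ^ 2 * (6 * KZ')) + 1024 * M ^ 2 * X * X :=
        add_le_add_left (mul_le_mul_of_nonneg_left hchain (by norm_num : (0 : ℝ) ≤ 2)) _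
    _ = (96 * KZ' + 1024 * M ^ 2) * X ^ 2 := by ring

end MeanSquare


/-! ### §8 Cramér's form `∫_1^Y (ψ − y)² dy/y² ≪ log Y` and the logarithmic variable (MV (13.17)–(13.18)) -/

section Dyadic
open scoped Chebyshev

/-- `(ψ y − y)²/y²` is interval integrable on `[a, b]` for `1 ≤ a ≤ b` (bounded and measurable). [folklore] -/
private theorem intervalIntegrable_sq_psi_sub_div_sq {a b : ℝ} (ha : 1 ≤ a) (hab : a ≤ b) :
    IntervalIntegrable (fun y ↦ (ψ y - y) ^ 2 / y ^ 2) MeasureTheory.volume a b := by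
  rw [intervalIntegrable_iff_integrableOn_Ioc_of_le hab]
  have hmeas : Measurable fun y : ℝ ↦ (ψ y - y) ^ 2 / y ^ 2 :=
    ((Chebyshev.psi_mono.measurable.sub measurable_id).pow_const 2).div (measurable_id.pow_const 2)
  refine MeasureTheory.Measure.integrableOn_of_bounded (M := (ψ b + b) ^ 2) (by simp)
    hmeas.aestronglyMeasurable ?_
  refine (MeasureTheory.ae_restrict_iff' measurableSet_Ioc).2 (Filter.Eventually.of_forall fun y hy ↦ ?_)
  have hy1 : 1 ≤ y := ha.trans hy.1.le
  have hψ := Chebyshev.psi_mono hy.2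
  have hψ0 := Chebyshev.psi_nonneg y
  have hsq : (ψ y - y) ^ 2 ≤ (ψ b + b) ^ 2 := by
    rw [← sq_abs (ψ y - y), ← sq_abs (ψ b + b)]
    refine pow_le_pow_left₀ (abs_nonneg _) ?_ 2
    rw [abs_le, abs_of_nonneg (by linarith)]
    constructor <;> linarith [hy.2]
  rw [Real.norm_eq_abs, abs_of_nonneg (by positivity)]
  calc (ψ y - y) ^ 2 / y ^ 2 ≤ (ψ y - y) ^ 2 / 1 := by
        refine div_le_div_of_nonneg_left (sq_nonneg _) one_pos ?_; nlinarith
    _ ≤ (ψ b + b) ^ 2 := by rw [div_one]; exact hsq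

/-- The block `[1, 2]`: `∫_1^2 (ψ − y)²/y² ≤ 200` (crude: `ψ ≤ (log 4 + 4)·2` there). [folklore] -/
private theorem integral_sq_psi_sub_div_sq_one_two_le : ∫ y in (1 : ℝ)..2, (ψ y - y) ^ 2 / y ^ 2 ≤ 200 := by
  have h := intervalIntegral.integral_mono_on (by norm_num : (1 : ℝ) ≤ 2)
    (intervalIntegrable_sq_psi_sub_div_sq le_rfl (by norm_num : (1 : ℝ) ≤ 2))
    (intervalIntegrable_const (c := (200 : ℝ))) (fun y hy ↦ ?_)
  · rw [intervalIntegral.integral_const, smul_eq_mul] at h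
    linarith
  · have hy1 : 1 ≤ y := hy.1
    have hψ2 : ψ y ≤ 12 := by
      have h4 : Real.log 4 ≤ 2 := by
        rw [Real.log_le_iff_le_exp (by norm_num)]
        have he : (2.7 : ℝ) < Real.exp 1 := by have := Real.exp_one_gt_d9; linarith
        have he2 : Real.exp 2 = Real.exp 1 * Real.exp 1 := by rw [← Real.exp_add]; norm_num
        nlinarith [Real.exp_pos 1]
      have := Chebyshev.psi_le_const_mul_self (by linarith : (0 : ℝ) ≤ y)
      nlinarith [hy.2]
    have hψ0 := Chebyshev.psi_nonneg y
    have hsq : (ψ y - y) ^ 2 ≤ 14 ^ 2 := by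
      rw [← sq_abs (ψ y - y)]
      refine pow_le_pow_left₀ (abs_nonneg _) ?_ 2
      rw [abs_le]; constructor <;> linarith [hy.2]
    calc (ψ y - y) ^ 2 / y ^ 2 ≤ (ψ y - y) ^ 2 / 1 := by
          refine div_le_div_of_nonneg_left (sq_nonneg _) one_pos ?_; nlinarith
      _ ≤ 200 := by rw [div_one]; linarith

/-- A dyadic block `[X, 2X]`, `X ≥ 2`: `∫_X^{2X} (ψ − y)²/y² ≤ X⁻² ∫_X^{2X} (ψ − y)²`. [folklore] -/
private theorem integral_sq_psi_sub_div_sq_block_le {X : ℝ} (hX : 2 ≤ X) :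
    ∫ y in X..(2 * X), (ψ y - y) ^ 2 / y ^ 2 ≤ (1 / X ^ 2) * ∫ y in X..(2 * X), (ψ y - y) ^ 2 := by
  have hX0 : 0 < X := by linarith
  have hX2 : X ≤ 2 * X := by linarith
  rw [← intervalIntegral.integral_const_mul]
  refine intervalIntegral.integral_mono_on hX2 (intervalIntegrable_sq_psi_sub_div_sq (by linarith) hX2)
    ((intervalIntegrable_sq_psi_sub hX0.le hX2).const_mul _) fun y hy ↦ ?_
  rw [one_div, ← div_eq_inv_mul]
  exact div_le_div_of_nonneg_left (sq_nonneg _) (by positivity) (pow_le_pow_left₀ hX0.le hy.1 2)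

/-- **Cramér's form under RH**: `∃ K, ∀ Y ≥ 1, ∫_1^Y (ψ(y) − y)² dy/y² ≤ K (log Y + 1)` (dyadic summation of
Thm. 13.5; Cramér 1922). [cite: MontgomeryVaughan2007, Thm. 13.5, (13.17)-(13.18)] -/
theorem integral_sq_psi_sub_self_div_sq_le_of_RH (hRH : RiemannHypothesis) :
    ∃ K : ℝ, ∀ Y : ℝ, 1 ≤ Y → ∫ y in (1 : ℝ)..Y, (ψ y - y) ^ 2 / y ^ 2 ≤ K * (Real.log Y + 1) := by
  obtain ⟨K, hK⟩ := integral_sq_psi_sub_self_le_of_RH hRH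
  set K' := max K 0 with hK'
  refine ⟨2 * (200 + K'), fun Y hY ↦ ?_⟩
  have hY0 : 0 < Y := by linarith
  -- number of dyadic blocks
  set N : ℕ := ⌊Real.log Y / Real.log 2⌋₊ + 1 with hN
  have hlog2 : (1 : ℝ) / 2 < Real.log 2 := by have := Real.log_two_gt_d9; linarith
  have hlog20 : 0 < Real.log 2 := by linarith
  have hlogY : 0 ≤ Real.log Y := Real.log_nonneg hY
  have hN1 : (N : ℝ) ≤ 2 * Real.log Y + 1 := by
    have h1 : (⌊Real.log Y / Real.log 2⌋₊ : ℝ) ≤ Real.log Y / Real.log 2 := Nat.floor_le (by positivity)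
    have h2 : Real.log Y / Real.log 2 ≤ 2 * Real.log Y := by
      rw [div_le_iff₀ hlog20]; nlinarith
    rw [hN]; push_cast; linarith
  have hYN : Y ≤ (2 : ℝ) ^ N := by
    have h1 : Real.log Y / Real.log 2 < N := by rw [hN]; push_cast; exact Nat.lt_floor_add_one _
    have h2 : Real.log Y < N * Real.log 2 := by rwa [div_lt_iff₀ hlog20] at h1
    rw [← Real.log_pow] at h2
    exact (Real.log_lt_log_iff hY0 (by positivity)).1 h2 |>.le
  -- each block
  have hblock : ∀ j : ℕ, ∫ y in (2 : ℝ) ^ j..(2 : ℝ) ^ (j + 1), (ψ y - y) ^ 2 / y ^ 2 ≤ 200 + K' := by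
    intro j
    rcases Nat.eq_zero_or_pos j with hj | hj
    · subst hj
      have := integral_sq_psi_sub_div_sq_one_two_le
      norm_num at this ⊢
      linarith [le_max_right K 0]
    · have hXj : (2 : ℝ) ≤ 2 ^ j := by
        calc (2 : ℝ) = 2 ^ 1 := by norm_num
          _ ≤ 2 ^ j := pow_le_pow_right₀ (by norm_num) hj
      have hX0 : (0 : ℝ) < 2 ^ j := by positivity
      rw [pow_succ, mul_comm]
      calc ∫ y in (2 : ℝ) ^ j..2 * 2 ^ j, (ψ y - y) ^ 2 / y ^ 2
          ≤ (1 / (2 ^ j) ^ 2) * ∫ y in (2 : ℝ) ^ j..2 * 2 ^ j, (ψ y - y) ^ 2 :=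
            integral_sq_psi_sub_div_sq_block_le hXj
        _ ≤ (1 / (2 ^ j) ^ 2) * (K' * (2 ^ j) ^ 2) := by
            refine mul_le_mul_of_nonneg_left ((hK _ hXj).trans ?_) (by positivity)
            exact mul_le_mul_of_nonneg_right (le_max_left _ _) (by positivity)
        _ = K' := by field_simp
        _ ≤ 200 + K' := by linarith
  -- sum of the blocks
  have hint : ∀ k < N, IntervalIntegrable (fun y ↦ (ψ y - y) ^ 2 / y ^ 2) MeasureTheory.volume
      ((2 : ℝ) ^ k) ((2 : ℝ) ^ (k + 1)) := fun k _ ↦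
    intervalIntegrable_sq_psi_sub_div_sq (one_le_pow₀ (by norm_num))
      (pow_le_pow_right₀ (by norm_num) (Nat.le_succ k))
  have hsum := intervalIntegral.sum_integral_adjacent_intervals hint
  rw [pow_zero] at hsum
  have hle1 : ∫ y in (1 : ℝ)..Y, (ψ y - y) ^ 2 / y ^ 2 ≤ ∫ y in (1 : ℝ)..(2 : ℝ) ^ N, (ψ y - y) ^ 2 / y ^ 2 := by
    refine intervalIntegral.integral_mono_interval le_rfl hY hYN ?_
      (intervalIntegrable_sq_psi_sub_div_sq le_rfl (one_le_pow₀ (by norm_num)))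
    exact Filter.Eventually.of_forall fun y ↦ by positivity
  calc ∫ y in (1 : ℝ)..Y, (ψ y - y) ^ 2 / y ^ 2
      ≤ ∫ y in (1 : ℝ)..(2 : ℝ) ^ N, (ψ y - y) ^ 2 / y ^ 2 := hle1
    _ = ∑ k ∈ Finset.range N, ∫ y in (2 : ℝ) ^ k..(2 : ℝ) ^ (k + 1), (ψ y - y) ^ 2 / y ^ 2 := hsum.symm
    _ ≤ ∑ k ∈ Finset.range N, (200 + K') := Finset.sum_le_sum fun k _ ↦ hblock k
    _ = N * (200 + K') := by rw [Finset.sum_const, Finset.card_range, nsmul_eq_mul]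
    _ ≤ (2 * Real.log Y + 1) * (200 + K') := by gcongr
    _ ≤ 2 * (200 + K') * (Real.log Y + 1) := by nlinarith [le_max_right K 0]

/-- **Cramér's mean square in the logarithmic variable (MV (13.17)–(13.18)) under RH**:
`∃ K, ∀ V ≥ 0, ∫_0^V e^{−u} (ψ(e^u) − e^u)² du ≤ K (V + 1)` — i.e. `f(u) = (ψ(e^u) − e^u) e^{−u/2}` has
`∫_0^V |f|² ≪ V + 1`. [cite: MontgomeryVaughan2007, Thm. 13.5, (13.17)-(13.18)] -/
theorem integral_exp_neg_mul_sq_psi_exp_sub_le_of_RH (hRH : RiemannHypothesis) :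
    ∃ K : ℝ, ∀ V : ℝ, 0 ≤ V →
      ∫ u in (0 : ℝ)..V, Real.exp (-u) * (ψ (Real.exp u) - Real.exp u) ^ 2 ≤ K * (V + 1) := by
  obtain ⟨K, hK⟩ := integral_sq_psi_sub_self_div_sq_le_of_RH hRH
  refine ⟨K, fun V hV ↦ ?_⟩
  have hsub := intervalIntegral.integral_comp_mul_deriv_of_deriv_nonneg (a := 0) (b := V)
    (f := Real.exp) (f' := Real.exp) (g := fun y ↦ (ψ y - y) ^ 2 / y ^ 2)
    Real.continuous_exp.continuousOn (fun x _ ↦ Real.hasDerivAt_exp x) (fun x _ ↦ (Real.exp_pos x).le)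
  rw [Real.exp_zero] at hsub
  have e : ∫ u in (0 : ℝ)..V, Real.exp (-u) * (ψ (Real.exp u) - Real.exp u) ^ 2
      = ∫ u in (0 : ℝ)..V, ((fun y ↦ (ψ y - y) ^ 2 / y ^ 2) ∘ Real.exp) u * Real.exp u := by
    refine intervalIntegral.integral_congr fun u _ ↦ ?_
    simp only [Function.comp_apply, Real.exp_neg]
    have := Real.exp_pos u
    field_simp
  rw [e, hsub]
  have h := hK (Real.exp V) (by simpa using Real.one_le_exp_iff.2 hV |>.trans_eq' rfl)
  rw [Real.log_exp] at h
  exact h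

end Dyadic

end Literature.NumberTheory.LFunctions.CramerMeanSquare
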